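import Summits.Parity.GeneralizedHardyLittlewood.Theorems.PrimeLevelFamEdgeMomentsBeyondDiagonalDiagRemThreeThreeBose
import HarnessLib

/-!
# Route `PrimeLevelFamEdge`, crux K_A `MomentsBeyondDiagonal` (stmt-Parity-20007), line «petersson_layers» v4, stub `stub_diag`:
# **the SIXTEEN remainder kernels of order `(3,3)` under ONE set of constants (envelope exponent `8`), with the pointwise bounds of
# the six both-sided ones** (brick B4b of (R₃₃); the order-`(3,3)` twin of `…DiagRemOneThreeBose.twoSeq_eight₁₃`)

All sixteen continued Bose remainders `r_ab`, `a, b ≤ 3`, of the order-`(3,3)` remainder weight (hypothesis `hR` of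
`…DiagDecorOrderThreeThreeAssembly.orderThreeThree_target_of_poly_of_remainder`) are obtained here UNIFORMLY from the generic
two-sequence estimate, in exactly the `Π`-form printed in `hR` (moments `μ₂, μ₄, μ₆ = ∫₀¹logᵐv·v/(1+v²)²` explicit), under ONE
envelope constant `C₀` and the common envelope `9C₀(1+|log 2αY²|)⁸`; for the six kernels that carry a both-sided `P₂ ⊗ P₂` monomial
(`(a,b) ∈ {(0,0),(0,1),(1,0),(0,2),(2,0),(1,1)}`) the small- and large-argument pointwise bounds `|r_ab(y)| ≤ C₀√y` (`y ≤ 1`),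
`|r_ab(y)| ≤ C₀(1+log y)³` (`y ≥ 1`) come with the SAME `E_ab` — the inputs `hR2 / hRs / hRt` of
`…DiagRemBothSidedPow.abs_bothsided_primeSq_le_pow` (`N = 8`, `M = 3`).

* `abs_bose_rem_twoSeq_small_tail` — generic `(a,b)`: two-sequence estimate ∧ `|r_ab(y)| ≤ C₀√y` (`y ≤ 1`) ∧
  `|r_ab(y)| ≤ C₀(1+log y)^{a+b+1}` (`y ≥ 1`) under one constant (KMV form);
* `twoSeq_sixteen₃₃` — **the sixteen two-sequence estimates (disjunctive form) and the pointwise bounds of the six both-sided kernels.**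

Def-free; theorems only. Helper `--supports stmt-Parity-20007`; closes nothing; K_A, K_B and the Parity summit are NOT proved;
nothing about Landau–Siegel zeros.

## References
* E. Kowalski, P. Michel, J. VanderKam, J. reine angew. Math. 526 (2000), (22)–(28) pp. 12–15 and Prop. 5.1 p. 18.
  [cite: KowalskiMichelVanderKam2000, (23)–(28) and Prop. 5.1 — derivation (order-(3,3) remainder, inner sums)]
-/

noncomputable section

open Real MeasureTheory Finset

namespace Summit.Parity.GeneralizedHardyLittlewood.Theorems.MomentsBeyondDiagonal.DiagCorner

open Summit.Parity.GeneralizedHardyLittlewood.Theorems.BeyondDiagonalBeatsQuarter.Corner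
open Summit.Parity.GeneralizedHardyLittlewood.Theorems.MomentsBeyondDiagonal.DiagLines

/-- **Two-sequence estimate, small-argument AND large-argument pointwise bounds for `r_ab` (generic KMV form) under ONE constant.**
[cite: KowalskiMichelVanderKam2000, Prop. 5.1 — derivation (corner of the diagonal, general Q, remainder of the weight)] -/
theorem abs_bose_rem_twoSeq_small_tail (a b : ℕ) : ∃ C₀ : ℝ, 0 ≤ C₀ ∧
    (∀ (a₁ a₂ : ℕ → ℝ) (Y α B η : ℝ) (K₁ i j : ℕ), 1 ≤ Y → 0 < α → 1 ≤ i → 1 ≤ j →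
      (∀ e : ℕ, e ≤ ⌊Y⌋₊ → |∑ k ∈ Icc 1 e, a₂ k| ≤ B) → (∀ e : ℕ, K₁ ≤ e → |∑ k ∈ Icc 1 e, a₁ k| ≤ η) →
      2 * α * K₁ * Y ≤ 1 →
    |∑ k₁ ∈ Icc 1 ⌊Y⌋₊, ∑ k₂ ∈ Icc 1 ⌊Y⌋₊,
        a₁ k₁ * a₂ k₂ * ellp Y k₁ ^ i * ellp Y k₂ ^ j *
          ((∫ u₁ in Set.Ioi (0 : ℝ), Real.log u₁ ^ a *
              ∫ u₂ in Set.Ioi ((α * k₁ * k₂) / u₁), Real.exp (-(u₁ + u₂)) / (1 - Real.exp (-(u₁ + u₂))) ^ 2 *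
                Real.log u₂ ^ b) -
            ((∫ u₁ in Set.Ioi (0 : ℝ), Real.log u₁ ^ a *
                ∫ u₂ in Set.Ioi (1 / u₁), Real.exp (-(u₁ + u₂)) / (1 - Real.exp (-(u₁ + u₂))) ^ 2 * Real.log u₂ ^ b) +
              (∫ η in Set.Ioc (0 : ℝ) 1, (η * (∫ u in Set.Ioi (0 : ℝ), Real.log u ^ a * Real.log (η / u) ^ b *
                  (Real.exp (-(u + η / u)) / (1 - Real.exp (-(u + η / u))) ^ 2) / u) -
                ∫ v in Set.Ioc (0 : ℝ) 1, ((-(Real.log (1 / η) / 2) + Real.log v) ^ a *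
                    (-(Real.log (1 / η) / 2) - Real.log v) ^ b +
                  (-(Real.log (1 / η) / 2) - Real.log v) ^ a * (-(Real.log (1 / η) / 2) + Real.log v) ^ b) *
                  (v / (1 + v ^ 2) ^ 2)) / η) +
              ∑ i' ∈ Finset.range (a + 1), ∑ j' ∈ Finset.range (b + 1),
                (a.choose i' : ℝ) * (b.choose j' : ℝ) * ((-1) ^ j' + (-1) ^ i') *
                  (∫ v in Set.Ioc (0 : ℝ) 1, Real.log v ^ (i' + j') * (v / (1 + v ^ 2) ^ 2)) *
                  ((-1 / 2 : ℝ) ^ (a - i' + (b - j')) * Real.log (1 / (α * k₁ * k₂)) ^ (a - i' + (b - j') + 1) /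
                    (((a - i' + (b - j') : ℕ) : ℝ) + 1))))| ≤
      (∑ k ∈ Icc 1 ⌊Y⌋₊, |a₁ k| * ellp Y k ^ i) *
          (B * (Real.log Y ^ j * (3 * C₀ * Real.sqrt (2 * α * K₁ * Y)))) +
        (∑ k ∈ Icc 1 ⌊Y⌋₊, |a₂ k| * ellp Y k ^ j) * ((2 * η) * (Real.log Y ^ i *
          (3 * (C₀ + C₀ * (1 + |Real.log (2 * α * Y ^ 2)|) ^ (a + b + 1)) + 2 * C₀ +
            C₀ * (1 + |Real.log (2 * α * Y ^ 2)|) ^ (a + b + 1) * (1 + |Real.log (2 * α * Y ^ 2)|))))) ∧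
    (∀ y : ℝ, 0 < y → y ≤ 1 →
      |((∫ u₁ in Set.Ioi (0 : ℝ), Real.log u₁ ^ a *
              ∫ u₂ in Set.Ioi (y / u₁), Real.exp (-(u₁ + u₂)) / (1 - Real.exp (-(u₁ + u₂))) ^ 2 *
                Real.log u₂ ^ b) -
            ((∫ u₁ in Set.Ioi (0 : ℝ), Real.log u₁ ^ a *
                ∫ u₂ in Set.Ioi (1 / u₁), Real.exp (-(u₁ + u₂)) / (1 - Real.exp (-(u₁ + u₂))) ^ 2 * Real.log u₂ ^ b) +
              (∫ η in Set.Ioc (0 : ℝ) 1, (η * (∫ u in Set.Ioi (0 : ℝ), Real.log u ^ a * Real.log (η / u) ^ b *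
                  (Real.exp (-(u + η / u)) / (1 - Real.exp (-(u + η / u))) ^ 2) / u) -
                ∫ v in Set.Ioc (0 : ℝ) 1, ((-(Real.log (1 / η) / 2) + Real.log v) ^ a *
                    (-(Real.log (1 / η) / 2) - Real.log v) ^ b +
                  (-(Real.log (1 / η) / 2) - Real.log v) ^ a * (-(Real.log (1 / η) / 2) + Real.log v) ^ b) *
                  (v / (1 + v ^ 2) ^ 2)) / η) +
              ∑ i' ∈ Finset.range (a + 1), ∑ j' ∈ Finset.range (b + 1),
                (a.choose i' : ℝ) * (b.choose j' : ℝ) * ((-1) ^ j' + (-1) ^ i') *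
                  (∫ v in Set.Ioc (0 : ℝ) 1, Real.log v ^ (i' + j') * (v / (1 + v ^ 2) ^ 2)) *
                  ((-1 / 2 : ℝ) ^ (a - i' + (b - j')) * Real.log (1 / y) ^ (a - i' + (b - j') + 1) /
                    (((a - i' + (b - j') : ℕ) : ℝ) + 1))))| ≤ C₀ * Real.sqrt y) ∧
    (∀ y : ℝ, 1 ≤ y →
      |((∫ u₁ in Set.Ioi (0 : ℝ), Real.log u₁ ^ a *
              ∫ u₂ in Set.Ioi (y / u₁), Real.exp (-(u₁ + u₂)) / (1 - Real.exp (-(u₁ + u₂))) ^ 2 *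
                Real.log u₂ ^ b) -
            ((∫ u₁ in Set.Ioi (0 : ℝ), Real.log u₁ ^ a *
                ∫ u₂ in Set.Ioi (1 / u₁), Real.exp (-(u₁ + u₂)) / (1 - Real.exp (-(u₁ + u₂))) ^ 2 * Real.log u₂ ^ b) +
              (∫ η in Set.Ioc (0 : ℝ) 1, (η * (∫ u in Set.Ioi (0 : ℝ), Real.log u ^ a * Real.log (η / u) ^ b *
                  (Real.exp (-(u + η / u)) / (1 - Real.exp (-(u + η / u))) ^ 2) / u) -
                ∫ v in Set.Ioc (0 : ℝ) 1, ((-(Real.log (1 / η) / 2) + Real.log v) ^ a *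
                    (-(Real.log (1 / η) / 2) - Real.log v) ^ b +
                  (-(Real.log (1 / η) / 2) - Real.log v) ^ a * (-(Real.log (1 / η) / 2) + Real.log v) ^ b) *
                  (v / (1 + v ^ 2) ^ 2)) / η) +
              ∑ i' ∈ Finset.range (a + 1), ∑ j' ∈ Finset.range (b + 1),
                (a.choose i' : ℝ) * (b.choose j' : ℝ) * ((-1) ^ j' + (-1) ^ i') *
                  (∫ v in Set.Ioc (0 : ℝ) 1, Real.log v ^ (i' + j') * (v / (1 + v ^ 2) ^ 2)) *
                  ((-1 / 2 : ℝ) ^ (a - i' + (b - j')) * Real.log (1 / y) ^ (a - i' + (b - j') + 1) /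
                    (((a - i' + (b - j') : ℕ) : ℝ) + 1))))| ≤ C₀ * (1 + Real.log y) ^ (a + b + 1)) := by
  obtain ⟨C₁, hC₁, h₁, hs⟩ := abs_bose_rem_twoSeq_and_small a b
  obtain ⟨Ct, ht⟩ := abs_bose_rem_tail_le a b
  set C₀ : ℝ := max C₁ |Ct| with hC₀
  have e₁ : C₁ ≤ C₀ := le_max_left _ _
  have et : Ct ≤ C₀ := (le_abs_self _).trans (le_max_right _ _)
  have hC₀0 : 0 ≤ C₀ := hC₁.trans e₁
  refine ⟨C₀, hC₀0, fun a₁ a₂ Y α B η K₁ i j hY hα hi hj hB hη hY₁ ↦ ?_, fun y hy0 hy1 ↦ ?_, fun y hy ↦ ?_⟩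
  · have hη0 : 0 ≤ η := (abs_nonneg _).trans (hη K₁ le_rfl)
    have hLY : 0 ≤ Real.log Y := Real.log_nonneg hY
    have hSj : 0 ≤ ∑ k ∈ Icc 1 ⌊Y⌋₊, |a₂ k| * ellp Y k ^ j :=
      Finset.sum_nonneg fun k _ ↦ mul_nonneg (abs_nonneg _) (pow_nonneg (ellp_nonneg Y k) j)
    have hSi : 0 ≤ ∑ k ∈ Icc 1 ⌊Y⌋₊, |a₁ k| * ellp Y k ^ i :=
      Finset.sum_nonneg fun k _ ↦ mul_nonneg (abs_nonneg _) (pow_nonneg (ellp_nonneg Y k) i)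
    have hB0 : 0 ≤ B := (abs_nonneg _).trans (hB 0 (Nat.zero_le _))
    have hsq : 0 ≤ Real.sqrt (2 * α * K₁ * Y) := Real.sqrt_nonneg _
    have hLi : 0 ≤ Real.log Y ^ i := pow_nonneg hLY i
    have hLj : 0 ≤ Real.log Y ^ j := pow_nonneg hLY j
    have hxN : 0 ≤ (1 + |Real.log (2 * α * Y ^ 2)|) ^ (a + b + 1) := pow_nonneg (by positivity) _
    have hx0 : 0 ≤ 1 + |Real.log (2 * α * Y ^ 2)| := by positivity
    refine (h₁ a₁ a₂ Y α B η K₁ i j hY hα hi hj hB hη hY₁).trans ?_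
    gcongr
  · exact (hs y hy0 hy1).trans (mul_le_mul_of_nonneg_right e₁ (Real.sqrt_nonneg y))
  · have h0 : 0 ≤ (1 + Real.log y) ^ (a + b + 1) := pow_nonneg (by linarith [Real.log_nonneg hy]) _
    exact (ht y hy).trans (mul_le_mul_of_nonneg_right et h0)

set_option linter.unusedSimpArgs false in
set_option maxHeartbeats 3200000 in
-- many kernels, large statement; one generated simp set for all kernels
/-- **The ten one-sided remainder kernels of order `(3,3)` (`r₀₃, r₁₂, r₁₃, r₂₁, r₂₂, r₂₃, r₃₀, r₃₁, r₃₂, r₃₃`) under one set of constants, envelope exponent `8`** (module docstring). [cite: KowalskiMichelVanderKam2000, (23)–(28) and Prop. 5.1 — derivation (order-(3,3) remainder, inner sums)] -/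
theorem twoSeq_ten₃₃ : ∃ E₀₃ E₁₂ E₁₃ E₂₁ E₂₂ E₂₃ E₃₀ E₃₁ E₃₂ E₃₃ C₀ : ℝ, 0 ≤ C₀ ∧
    (∀ R : ℝ → ℝ,
      (R = (fun y : ℝ ↦ (∫ u₁ in Set.Ioi (0 : ℝ), ∫ u₂ in Set.Ioi (y / u₁),
              Real.exp (-(u₁ + u₂)) / (1 - Real.exp (-(u₁ + u₂))) ^ 2 * Real.log u₂ ^ 3) -
            (-(Real.log (1 / y) ^ 4) / 64 - 3 * (∫ v in Set.Ioc (0 : ℝ) 1, Real.log v ^ 2 * (v / (1 + v ^ 2) ^ 2)) / 2 * Real.log (1 / y) ^ 2 + E₀₃)) ∨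
       R = (fun y : ℝ ↦ (∫ u₁ in Set.Ioi (0 : ℝ), Real.log u₁ * ∫ u₂ in Set.Ioi (y / u₁),
              Real.exp (-(u₁ + u₂)) / (1 - Real.exp (-(u₁ + u₂))) ^ 2 * Real.log u₂ ^ 2) -
            (-(Real.log (1 / y) ^ 4) / 64 + (∫ v in Set.Ioc (0 : ℝ) 1, Real.log v ^ 2 * (v / (1 + v ^ 2) ^ 2)) / 2 * Real.log (1 / y) ^ 2 + E₁₂)) ∨
       R = (fun y : ℝ ↦ (∫ u₁ in Set.Ioi (0 : ℝ), Real.log u₁ * ∫ u₂ in Set.Ioi (y / u₁),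
              Real.exp (-(u₁ + u₂)) / (1 - Real.exp (-(u₁ + u₂))) ^ 2 * Real.log u₂ ^ 3) -
            (Real.log (1 / y) ^ 5 / 160 - 2 * (∫ v in Set.Ioc (0 : ℝ) 1, Real.log v ^ 4 * (v / (1 + v ^ 2) ^ 2)) * Real.log (1 / y) + E₁₃)) ∨
       R = (fun y : ℝ ↦ (∫ u₁ in Set.Ioi (0 : ℝ), Real.log u₁ ^ 2 * ∫ u₂ in Set.Ioi (y / u₁),
              Real.exp (-(u₁ + u₂)) / (1 - Real.exp (-(u₁ + u₂))) ^ 2 * Real.log u₂) -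
            (-(Real.log (1 / y) ^ 4) / 64 + (∫ v in Set.Ioc (0 : ℝ) 1, Real.log v ^ 2 * (v / (1 + v ^ 2) ^ 2)) / 2 * Real.log (1 / y) ^ 2 + E₂₁)) ∨
       R = (fun y : ℝ ↦ (∫ u₁ in Set.Ioi (0 : ℝ), Real.log u₁ ^ 2 * ∫ u₂ in Set.Ioi (y / u₁),
              Real.exp (-(u₁ + u₂)) / (1 - Real.exp (-(u₁ + u₂))) ^ 2 * Real.log u₂ ^ 2) -
            (Real.log (1 / y) ^ 5 / 160 - (∫ v in Set.Ioc (0 : ℝ) 1, Real.log v ^ 2 * (v / (1 + v ^ 2) ^ 2)) / 3 * Real.log (1 / y) ^ 3 + 2 * (∫ v in Set.Ioc (0 : ℝ) 1, Real.log v ^ 4 * (v / (1 + v ^ 2) ^ 2)) * Real.log (1 / y) + E₂₂)) ∨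
       R = (fun y : ℝ ↦ (∫ u₁ in Set.Ioi (0 : ℝ), Real.log u₁ ^ 2 * ∫ u₂ in Set.Ioi (y / u₁),
              Real.exp (-(u₁ + u₂)) / (1 - Real.exp (-(u₁ + u₂))) ^ 2 * Real.log u₂ ^ 3) -
            (-(Real.log (1 / y) ^ 6) / 384 + (∫ v in Set.Ioc (0 : ℝ) 1, Real.log v ^ 2 * (v / (1 + v ^ 2) ^ 2)) / 8 * Real.log (1 / y) ^ 4 - (∫ v in Set.Ioc (0 : ℝ) 1, Real.log v ^ 4 * (v / (1 + v ^ 2) ^ 2)) / 2 * Real.log (1 / y) ^ 2 + E₂₃)) ∨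
       R = (fun y : ℝ ↦ (∫ u₁ in Set.Ioi (0 : ℝ), Real.log u₁ ^ 3 * ∫ u₂ in Set.Ioi (y / u₁),
              Real.exp (-(u₁ + u₂)) / (1 - Real.exp (-(u₁ + u₂))) ^ 2) -
            (-(Real.log (1 / y) ^ 4) / 64 - 3 * (∫ v in Set.Ioc (0 : ℝ) 1, Real.log v ^ 2 * (v / (1 + v ^ 2) ^ 2)) / 2 * Real.log (1 / y) ^ 2 + E₃₀)) ∨
       R = (fun y : ℝ ↦ (∫ u₁ in Set.Ioi (0 : ℝ), Real.log u₁ ^ 3 * ∫ u₂ in Set.Ioi (y / u₁),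
              Real.exp (-(u₁ + u₂)) / (1 - Real.exp (-(u₁ + u₂))) ^ 2 * Real.log u₂) -
            (Real.log (1 / y) ^ 5 / 160 - 2 * (∫ v in Set.Ioc (0 : ℝ) 1, Real.log v ^ 4 * (v / (1 + v ^ 2) ^ 2)) * Real.log (1 / y) + E₃₁)) ∨
       R = (fun y : ℝ ↦ (∫ u₁ in Set.Ioi (0 : ℝ), Real.log u₁ ^ 3 * ∫ u₂ in Set.Ioi (y / u₁),
              Real.exp (-(u₁ + u₂)) / (1 - Real.exp (-(u₁ + u₂))) ^ 2 * Real.log u₂ ^ 2) -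
            (-(Real.log (1 / y) ^ 6) / 384 + (∫ v in Set.Ioc (0 : ℝ) 1, Real.log v ^ 2 * (v / (1 + v ^ 2) ^ 2)) / 8 * Real.log (1 / y) ^ 4 - (∫ v in Set.Ioc (0 : ℝ) 1, Real.log v ^ 4 * (v / (1 + v ^ 2) ^ 2)) / 2 * Real.log (1 / y) ^ 2 + E₃₂)) ∨
       R = (fun y : ℝ ↦ (∫ u₁ in Set.Ioi (0 : ℝ), Real.log u₁ ^ 3 * ∫ u₂ in Set.Ioi (y / u₁),
              Real.exp (-(u₁ + u₂)) / (1 - Real.exp (-(u₁ + u₂))) ^ 2 * Real.log u₂ ^ 3) -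
            (Real.log (1 / y) ^ 7 / 896 - 3 * (∫ v in Set.Ioc (0 : ℝ) 1, Real.log v ^ 2 * (v / (1 + v ^ 2) ^ 2)) / 40 * Real.log (1 / y) ^ 5 + (∫ v in Set.Ioc (0 : ℝ) 1, Real.log v ^ 4 * (v / (1 + v ^ 2) ^ 2)) / 2 * Real.log (1 / y) ^ 3 - 2 * (∫ v in Set.Ioc (0 : ℝ) 1, Real.log v ^ 6 * (v / (1 + v ^ 2) ^ 2)) * Real.log (1 / y) + E₃₃))) →
      ∀ (a₁ a₂ : ℕ → ℝ) (Y α B η : ℝ) (K₁ i j : ℕ), 1 ≤ Y → 0 < α → 1 ≤ i → 1 ≤ j →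
        (∀ e : ℕ, e ≤ ⌊Y⌋₊ → |∑ k ∈ Icc 1 e, a₂ k| ≤ B) → (∀ e : ℕ, K₁ ≤ e → |∑ k ∈ Icc 1 e, a₁ k| ≤ η) →
        2 * α * K₁ * Y ≤ 1 →
      |∑ k₁ ∈ Icc 1 ⌊Y⌋₊, ∑ k₂ ∈ Icc 1 ⌊Y⌋₊,
          a₁ k₁ * a₂ k₂ * ellp Y k₁ ^ i * ellp Y k₂ ^ j * R (α * k₁ * k₂)| ≤
        (∑ k ∈ Icc 1 ⌊Y⌋₊, |a₁ k| * ellp Y k ^ i) * (B * (Real.log Y ^ j * (3 * C₀ * Real.sqrt (2 * α * K₁ * Y)))) +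
          (∑ k ∈ Icc 1 ⌊Y⌋₊, |a₂ k| * ellp Y k ^ j) *
            ((2 * η) * (Real.log Y ^ i * (9 * C₀ * (1 + |Real.log (2 * α * Y ^ 2)|) ^ 8)))) := by
  obtain ⟨C₀₃, hC₀₃, h₀₃, hs₀₃, ht₀₃⟩ := abs_bose_rem_twoSeq_small_tail 0 3
  obtain ⟨C₁₂, hC₁₂, h₁₂, hs₁₂, ht₁₂⟩ := abs_bose_rem_twoSeq_small_tail 1 2
  obtain ⟨C₁₃, hC₁₃, h₁₃, hs₁₃, ht₁₃⟩ := abs_bose_rem_twoSeq_small_tail 1 3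
  obtain ⟨C₂₁, hC₂₁, h₂₁, hs₂₁, ht₂₁⟩ := abs_bose_rem_twoSeq_small_tail 2 1
  obtain ⟨C₂₂, hC₂₂, h₂₂, hs₂₂, ht₂₂⟩ := abs_bose_rem_twoSeq_small_tail 2 2
  obtain ⟨C₂₃, hC₂₃, h₂₃, hs₂₃, ht₂₃⟩ := abs_bose_rem_twoSeq_small_tail 2 3
  obtain ⟨C₃₀, hC₃₀, h₃₀, hs₃₀, ht₃₀⟩ := abs_bose_rem_twoSeq_small_tail 3 0
  obtain ⟨C₃₁, hC₃₁, h₃₁, hs₃₁, ht₃₁⟩ := abs_bose_rem_twoSeq_small_tail 3 1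
  obtain ⟨C₃₂, hC₃₂, h₃₂, hs₃₂, ht₃₂⟩ := abs_bose_rem_twoSeq_small_tail 3 2
  obtain ⟨C₃₃, hC₃₃, h₃₃, hs₃₃, ht₃₃⟩ := abs_bose_rem_twoSeq_small_tail 3 3
  set C₀ : ℝ := C₀₃ + C₁₂ + C₁₃ + C₂₁ + C₂₂ + C₂₃ + C₃₀ + C₃₁ + C₃₂ + C₃₃ with hC₀
  have hC₀0 : 0 ≤ C₀ := by rw [hC₀]; positivity
  have e₀₃ : C₀₃ ≤ C₀ := by rw [hC₀]; linarith [hC₀₃, hC₁₂, hC₁₃, hC₂₁, hC₂₂, hC₂₃, hC₃₀, hC₃₁, hC₃₂, hC₃₃]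
  have e₁₂ : C₁₂ ≤ C₀ := by rw [hC₀]; linarith [hC₀₃, hC₁₂, hC₁₃, hC₂₁, hC₂₂, hC₂₃, hC₃₀, hC₃₁, hC₃₂, hC₃₃]
  have e₁₃ : C₁₃ ≤ C₀ := by rw [hC₀]; linarith [hC₀₃, hC₁₂, hC₁₃, hC₂₁, hC₂₂, hC₂₃, hC₃₀, hC₃₁, hC₃₂, hC₃₃]
  have e₂₁ : C₂₁ ≤ C₀ := by rw [hC₀]; linarith [hC₀₃, hC₁₂, hC₁₃, hC₂₁, hC₂₂, hC₂₃, hC₃₀, hC₃₁, hC₃₂, hC₃₃]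
  have e₂₂ : C₂₂ ≤ C₀ := by rw [hC₀]; linarith [hC₀₃, hC₁₂, hC₁₃, hC₂₁, hC₂₂, hC₂₃, hC₃₀, hC₃₁, hC₃₂, hC₃₃]
  have e₂₃ : C₂₃ ≤ C₀ := by rw [hC₀]; linarith [hC₀₃, hC₁₂, hC₁₃, hC₂₁, hC₂₂, hC₂₃, hC₃₀, hC₃₁, hC₃₂, hC₃₃]
  have e₃₀ : C₃₀ ≤ C₀ := by rw [hC₀]; linarith [hC₀₃, hC₁₂, hC₁₃, hC₂₁, hC₂₂, hC₂₃, hC₃₀, hC₃₁, hC₃₂, hC₃₃]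
  have e₃₁ : C₃₁ ≤ C₀ := by rw [hC₀]; linarith [hC₀₃, hC₁₂, hC₁₃, hC₂₁, hC₂₂, hC₂₃, hC₃₀, hC₃₁, hC₃₂, hC₃₃]
  have e₃₂ : C₃₂ ≤ C₀ := by rw [hC₀]; linarith [hC₀₃, hC₁₂, hC₁₃, hC₂₁, hC₂₂, hC₂₃, hC₃₀, hC₃₁, hC₃₂, hC₃₃]
  have e₃₃ : C₃₃ ≤ C₀ := by rw [hC₀]; linarith [hC₀₃, hC₁₂, hC₁₃, hC₂₁, hC₂₂, hC₂₃, hC₃₀, hC₃₁, hC₃₂, hC₃₃]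
  have hc32 : Nat.choose 3 2 = 3 := by decide
  refine ⟨(∫ u₁ in Set.Ioi (0 : ℝ), Real.log u₁ ^ 0 * ∫ u₂ in Set.Ioi (1 / u₁), Real.exp (-(u₁ + u₂)) / (1 - Real.exp (-(u₁ + u₂))) ^ 2 * Real.log u₂ ^ 3) +
      (∫ η in Set.Ioc (0 : ℝ) 1, (η * (∫ u in Set.Ioi (0 : ℝ), Real.log u ^ 0 * Real.log (η / u) ^ 3 * (Real.exp (-(u + η / u)) / (1 - Real.exp (-(u + η / u))) ^ 2) / u) -
          ∫ v in Set.Ioc (0 : ℝ) 1, ((-(Real.log (1 / η) / 2) + Real.log v) ^ 0 * (-(Real.log (1 / η) / 2) - Real.log v) ^ 3 +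
              (-(Real.log (1 / η) / 2) - Real.log v) ^ 0 * (-(Real.log (1 / η) / 2) + Real.log v) ^ 3) * (v / (1 + v ^ 2) ^ 2)) / η),
    (∫ u₁ in Set.Ioi (0 : ℝ), Real.log u₁ ^ 1 * ∫ u₂ in Set.Ioi (1 / u₁), Real.exp (-(u₁ + u₂)) / (1 - Real.exp (-(u₁ + u₂))) ^ 2 * Real.log u₂ ^ 2) +
      (∫ η in Set.Ioc (0 : ℝ) 1, (η * (∫ u in Set.Ioi (0 : ℝ), Real.log u ^ 1 * Real.log (η / u) ^ 2 * (Real.exp (-(u + η / u)) / (1 - Real.exp (-(u + η / u))) ^ 2) / u) -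
          ∫ v in Set.Ioc (0 : ℝ) 1, ((-(Real.log (1 / η) / 2) + Real.log v) ^ 1 * (-(Real.log (1 / η) / 2) - Real.log v) ^ 2 +
              (-(Real.log (1 / η) / 2) - Real.log v) ^ 1 * (-(Real.log (1 / η) / 2) + Real.log v) ^ 2) * (v / (1 + v ^ 2) ^ 2)) / η),
    (∫ u₁ in Set.Ioi (0 : ℝ), Real.log u₁ ^ 1 * ∫ u₂ in Set.Ioi (1 / u₁), Real.exp (-(u₁ + u₂)) / (1 - Real.exp (-(u₁ + u₂))) ^ 2 * Real.log u₂ ^ 3) +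
      (∫ η in Set.Ioc (0 : ℝ) 1, (η * (∫ u in Set.Ioi (0 : ℝ), Real.log u ^ 1 * Real.log (η / u) ^ 3 * (Real.exp (-(u + η / u)) / (1 - Real.exp (-(u + η / u))) ^ 2) / u) -
          ∫ v in Set.Ioc (0 : ℝ) 1, ((-(Real.log (1 / η) / 2) + Real.log v) ^ 1 * (-(Real.log (1 / η) / 2) - Real.log v) ^ 3 +
              (-(Real.log (1 / η) / 2) - Real.log v) ^ 1 * (-(Real.log (1 / η) / 2) + Real.log v) ^ 3) * (v / (1 + v ^ 2) ^ 2)) / η),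
    (∫ u₁ in Set.Ioi (0 : ℝ), Real.log u₁ ^ 2 * ∫ u₂ in Set.Ioi (1 / u₁), Real.exp (-(u₁ + u₂)) / (1 - Real.exp (-(u₁ + u₂))) ^ 2 * Real.log u₂ ^ 1) +
      (∫ η in Set.Ioc (0 : ℝ) 1, (η * (∫ u in Set.Ioi (0 : ℝ), Real.log u ^ 2 * Real.log (η / u) ^ 1 * (Real.exp (-(u + η / u)) / (1 - Real.exp (-(u + η / u))) ^ 2) / u) -
          ∫ v in Set.Ioc (0 : ℝ) 1, ((-(Real.log (1 / η) / 2) + Real.log v) ^ 2 * (-(Real.log (1 / η) / 2) - Real.log v) ^ 1 +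
              (-(Real.log (1 / η) / 2) - Real.log v) ^ 2 * (-(Real.log (1 / η) / 2) + Real.log v) ^ 1) * (v / (1 + v ^ 2) ^ 2)) / η),
    (∫ u₁ in Set.Ioi (0 : ℝ), Real.log u₁ ^ 2 * ∫ u₂ in Set.Ioi (1 / u₁), Real.exp (-(u₁ + u₂)) / (1 - Real.exp (-(u₁ + u₂))) ^ 2 * Real.log u₂ ^ 2) +
      (∫ η in Set.Ioc (0 : ℝ) 1, (η * (∫ u in Set.Ioi (0 : ℝ), Real.log u ^ 2 * Real.log (η / u) ^ 2 * (Real.exp (-(u + η / u)) / (1 - Real.exp (-(u + η / u))) ^ 2) / u) -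
          ∫ v in Set.Ioc (0 : ℝ) 1, ((-(Real.log (1 / η) / 2) + Real.log v) ^ 2 * (-(Real.log (1 / η) / 2) - Real.log v) ^ 2 +
              (-(Real.log (1 / η) / 2) - Real.log v) ^ 2 * (-(Real.log (1 / η) / 2) + Real.log v) ^ 2) * (v / (1 + v ^ 2) ^ 2)) / η),
    (∫ u₁ in Set.Ioi (0 : ℝ), Real.log u₁ ^ 2 * ∫ u₂ in Set.Ioi (1 / u₁), Real.exp (-(u₁ + u₂)) / (1 - Real.exp (-(u₁ + u₂))) ^ 2 * Real.log u₂ ^ 3) +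
      (∫ η in Set.Ioc (0 : ℝ) 1, (η * (∫ u in Set.Ioi (0 : ℝ), Real.log u ^ 2 * Real.log (η / u) ^ 3 * (Real.exp (-(u + η / u)) / (1 - Real.exp (-(u + η / u))) ^ 2) / u) -
          ∫ v in Set.Ioc (0 : ℝ) 1, ((-(Real.log (1 / η) / 2) + Real.log v) ^ 2 * (-(Real.log (1 / η) / 2) - Real.log v) ^ 3 +
              (-(Real.log (1 / η) / 2) - Real.log v) ^ 2 * (-(Real.log (1 / η) / 2) + Real.log v) ^ 3) * (v / (1 + v ^ 2) ^ 2)) / η),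
    (∫ u₁ in Set.Ioi (0 : ℝ), Real.log u₁ ^ 3 * ∫ u₂ in Set.Ioi (1 / u₁), Real.exp (-(u₁ + u₂)) / (1 - Real.exp (-(u₁ + u₂))) ^ 2 * Real.log u₂ ^ 0) +
      (∫ η in Set.Ioc (0 : ℝ) 1, (η * (∫ u in Set.Ioi (0 : ℝ), Real.log u ^ 3 * Real.log (η / u) ^ 0 * (Real.exp (-(u + η / u)) / (1 - Real.exp (-(u + η / u))) ^ 2) / u) -
          ∫ v in Set.Ioc (0 : ℝ) 1, ((-(Real.log (1 / η) / 2) + Real.log v) ^ 3 * (-(Real.log (1 / η) / 2) - Real.log v) ^ 0 +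
              (-(Real.log (1 / η) / 2) - Real.log v) ^ 3 * (-(Real.log (1 / η) / 2) + Real.log v) ^ 0) * (v / (1 + v ^ 2) ^ 2)) / η),
    (∫ u₁ in Set.Ioi (0 : ℝ), Real.log u₁ ^ 3 * ∫ u₂ in Set.Ioi (1 / u₁), Real.exp (-(u₁ + u₂)) / (1 - Real.exp (-(u₁ + u₂))) ^ 2 * Real.log u₂ ^ 1) +
      (∫ η in Set.Ioc (0 : ℝ) 1, (η * (∫ u in Set.Ioi (0 : ℝ), Real.log u ^ 3 * Real.log (η / u) ^ 1 * (Real.exp (-(u + η / u)) / (1 - Real.exp (-(u + η / u))) ^ 2) / u) -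
          ∫ v in Set.Ioc (0 : ℝ) 1, ((-(Real.log (1 / η) / 2) + Real.log v) ^ 3 * (-(Real.log (1 / η) / 2) - Real.log v) ^ 1 +
              (-(Real.log (1 / η) / 2) - Real.log v) ^ 3 * (-(Real.log (1 / η) / 2) + Real.log v) ^ 1) * (v / (1 + v ^ 2) ^ 2)) / η),
    (∫ u₁ in Set.Ioi (0 : ℝ), Real.log u₁ ^ 3 * ∫ u₂ in Set.Ioi (1 / u₁), Real.exp (-(u₁ + u₂)) / (1 - Real.exp (-(u₁ + u₂))) ^ 2 * Real.log u₂ ^ 2) +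
      (∫ η in Set.Ioc (0 : ℝ) 1, (η * (∫ u in Set.Ioi (0 : ℝ), Real.log u ^ 3 * Real.log (η / u) ^ 2 * (Real.exp (-(u + η / u)) / (1 - Real.exp (-(u + η / u))) ^ 2) / u) -
          ∫ v in Set.Ioc (0 : ℝ) 1, ((-(Real.log (1 / η) / 2) + Real.log v) ^ 3 * (-(Real.log (1 / η) / 2) - Real.log v) ^ 2 +
              (-(Real.log (1 / η) / 2) - Real.log v) ^ 3 * (-(Real.log (1 / η) / 2) + Real.log v) ^ 2) * (v / (1 + v ^ 2) ^ 2)) / η),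
    (∫ u₁ in Set.Ioi (0 : ℝ), Real.log u₁ ^ 3 * ∫ u₂ in Set.Ioi (1 / u₁), Real.exp (-(u₁ + u₂)) / (1 - Real.exp (-(u₁ + u₂))) ^ 2 * Real.log u₂ ^ 3) +
      (∫ η in Set.Ioc (0 : ℝ) 1, (η * (∫ u in Set.Ioi (0 : ℝ), Real.log u ^ 3 * Real.log (η / u) ^ 3 * (Real.exp (-(u + η / u)) / (1 - Real.exp (-(u + η / u))) ^ 2) / u) -
          ∫ v in Set.Ioc (0 : ℝ) 1, ((-(Real.log (1 / η) / 2) + Real.log v) ^ 3 * (-(Real.log (1 / η) / 2) - Real.log v) ^ 3 +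
              (-(Real.log (1 / η) / 2) - Real.log v) ^ 3 * (-(Real.log (1 / η) / 2) + Real.log v) ^ 3) * (v / (1 + v ^ 2) ^ 2)) / η),
    C₀, hC₀0, ?_⟩
  · intro R hRR a₁ a₂ Y α B η K₁ i j hY hα hi hj hB hη hY₁
    have hY0 : 0 < Y := by linarith
    have hη0 : 0 ≤ η := (abs_nonneg _).trans (hη K₁ le_rfl)
    have hLY : 0 ≤ Real.log Y := Real.log_nonneg hY
    have hx : (1 : ℝ) ≤ 1 + |Real.log (2 * α * Y ^ 2)| := by linarith [abs_nonneg (Real.log (2 * α * Y ^ 2))]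
    have hSj : 0 ≤ ∑ k ∈ Icc 1 ⌊Y⌋₊, |a₂ k| * ellp Y k ^ j :=
      Finset.sum_nonneg fun k _ ↦ mul_nonneg (abs_nonneg _) (pow_nonneg (ellp_nonneg Y k) j)
    have hSi : 0 ≤ ∑ k ∈ Icc 1 ⌊Y⌋₊, |a₁ k| * ellp Y k ^ i :=
      Finset.sum_nonneg fun k _ ↦ mul_nonneg (abs_nonneg _) (pow_nonneg (ellp_nonneg Y k) i)
    have hB0 : 0 ≤ B := (abs_nonneg _).trans (hB 0 (Nat.zero_le _))
    have hsq : 0 ≤ Real.sqrt (2 * α * K₁ * Y) := Real.sqrt_nonneg _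
    have hfirst : ∀ {C : ℝ}, C ≤ C₀ →
        (∑ k ∈ Icc 1 ⌊Y⌋₊, |a₁ k| * ellp Y k ^ i) * (B * (Real.log Y ^ j * (3 * C * Real.sqrt (2 * α * K₁ * Y)))) ≤
        (∑ k ∈ Icc 1 ⌊Y⌋₊, |a₁ k| * ellp Y k ^ i) * (B * (Real.log Y ^ j * (3 * C₀ * Real.sqrt (2 * α * K₁ * Y)))) := by
      intro C hC
      have hLj : 0 ≤ Real.log Y ^ j := pow_nonneg hLY j
      gcongr
    have hsecond : ∀ {C : ℝ} {N : ℕ}, 0 ≤ C → C ≤ C₀ →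
        (∑ k ∈ Icc 1 ⌊Y⌋₊, |a₂ k| * ellp Y k ^ j) * ((2 * η) * (Real.log Y ^ i *
            (3 * (C + C * (1 + |Real.log (2 * α * Y ^ 2)|) ^ N) + 2 * C +
              C * (1 + |Real.log (2 * α * Y ^ 2)|) ^ N * (1 + |Real.log (2 * α * Y ^ 2)|)))) ≤
        (∑ k ∈ Icc 1 ⌊Y⌋₊, |a₂ k| * ellp Y k ^ j) * ((2 * η) * (Real.log Y ^ i *
            (3 * (C₀ + C₀ * (1 + |Real.log (2 * α * Y ^ 2)|) ^ N) + 2 * C₀ +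
              C₀ * (1 + |Real.log (2 * α * Y ^ 2)|) ^ N * (1 + |Real.log (2 * α * Y ^ 2)|)))) := by
      intro C N hC hCC
      have hLi : 0 ≤ Real.log Y ^ i := pow_nonneg hLY i
      have hxN : 0 ≤ (1 + |Real.log (2 * α * Y ^ 2)|) ^ N := pow_nonneg (by positivity) N
      gcongr
    rcases hRR with rfl | rfl | rfl | rfl | rfl | rfl | rfl | rfl | rfl | rfl
    · have h := h₀₃ a₁ a₂ Y α B η K₁ i j hY hα hi hj hB hη hY₁
      have h' := le_trans h (add_le_add (hfirst e₀₃) (hsecond hC₀₃ e₀₃))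
      have h'' := weaken_second_term8 hSj hη0 hLY hC₀0 hx (by norm_num : 0 + 3 + 1 ≤ 7) h'
      refine le_trans (le_of_eq ?_) h''
      congr 1
      refine Finset.sum_congr rfl fun k₁ _ ↦ Finset.sum_congr rfl fun k₂ _ ↦ ?_
      simp only [Finset.sum_range_succ, Finset.sum_range_zero, zero_add, add_zero, Nat.choose_self,
        Nat.choose_zero_right, Nat.choose_one_right, hc32, Nat.cast_one, Nat.cast_ofNat, Nat.sub_self, Nat.sub_zero,
        Nat.reduceSub, Nat.reduceAdd, Nat.cast_zero, Nat.cast_add, pow_zero, pow_one, one_mul, mul_one,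
        integral_model_weight_Ioc]
      ring
    · have h := h₁₂ a₁ a₂ Y α B η K₁ i j hY hα hi hj hB hη hY₁
      have h' := le_trans h (add_le_add (hfirst e₁₂) (hsecond hC₁₂ e₁₂))
      have h'' := weaken_second_term8 hSj hη0 hLY hC₀0 hx (by norm_num : 1 + 2 + 1 ≤ 7) h'
      refine le_trans (le_of_eq ?_) h''
      congr 1
      refine Finset.sum_congr rfl fun k₁ _ ↦ Finset.sum_congr rfl fun k₂ _ ↦ ?_
      simp only [Finset.sum_range_succ, Finset.sum_range_zero, zero_add, add_zero, Nat.choose_self,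
        Nat.choose_zero_right, Nat.choose_one_right, hc32, Nat.cast_one, Nat.cast_ofNat, Nat.sub_self, Nat.sub_zero,
        Nat.reduceSub, Nat.reduceAdd, Nat.cast_zero, Nat.cast_add, pow_zero, pow_one, one_mul, mul_one,
        integral_model_weight_Ioc]
      ring
    · have h := h₁₃ a₁ a₂ Y α B η K₁ i j hY hα hi hj hB hη hY₁
      have h' := le_trans h (add_le_add (hfirst e₁₃) (hsecond hC₁₃ e₁₃))
      have h'' := weaken_second_term8 hSj hη0 hLY hC₀0 hx (by norm_num : 1 + 3 + 1 ≤ 7) h'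
      refine le_trans (le_of_eq ?_) h''
      congr 1
      refine Finset.sum_congr rfl fun k₁ _ ↦ Finset.sum_congr rfl fun k₂ _ ↦ ?_
      simp only [Finset.sum_range_succ, Finset.sum_range_zero, zero_add, add_zero, Nat.choose_self,
        Nat.choose_zero_right, Nat.choose_one_right, hc32, Nat.cast_one, Nat.cast_ofNat, Nat.sub_self, Nat.sub_zero,
        Nat.reduceSub, Nat.reduceAdd, Nat.cast_zero, Nat.cast_add, pow_zero, pow_one, one_mul, mul_one,
        integral_model_weight_Ioc]
      ring
    · have h := h₂₁ a₁ a₂ Y α B η K₁ i j hY hα hi hj hB hη hY₁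
      have h' := le_trans h (add_le_add (hfirst e₂₁) (hsecond hC₂₁ e₂₁))
      have h'' := weaken_second_term8 hSj hη0 hLY hC₀0 hx (by norm_num : 2 + 1 + 1 ≤ 7) h'
      refine le_trans (le_of_eq ?_) h''
      congr 1
      refine Finset.sum_congr rfl fun k₁ _ ↦ Finset.sum_congr rfl fun k₂ _ ↦ ?_
      simp only [Finset.sum_range_succ, Finset.sum_range_zero, zero_add, add_zero, Nat.choose_self,
        Nat.choose_zero_right, Nat.choose_one_right, hc32, Nat.cast_one, Nat.cast_ofNat, Nat.sub_self, Nat.sub_zero,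
        Nat.reduceSub, Nat.reduceAdd, Nat.cast_zero, Nat.cast_add, pow_zero, pow_one, one_mul, mul_one,
        integral_model_weight_Ioc]
      ring
    · have h := h₂₂ a₁ a₂ Y α B η K₁ i j hY hα hi hj hB hη hY₁
      have h' := le_trans h (add_le_add (hfirst e₂₂) (hsecond hC₂₂ e₂₂))
      have h'' := weaken_second_term8 hSj hη0 hLY hC₀0 hx (by norm_num : 2 + 2 + 1 ≤ 7) h'
      refine le_trans (le_of_eq ?_) h''
      congr 1
      refine Finset.sum_congr rfl fun k₁ _ ↦ Finset.sum_congr rfl fun k₂ _ ↦ ?_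
      simp only [Finset.sum_range_succ, Finset.sum_range_zero, zero_add, add_zero, Nat.choose_self,
        Nat.choose_zero_right, Nat.choose_one_right, hc32, Nat.cast_one, Nat.cast_ofNat, Nat.sub_self, Nat.sub_zero,
        Nat.reduceSub, Nat.reduceAdd, Nat.cast_zero, Nat.cast_add, pow_zero, pow_one, one_mul, mul_one,
        integral_model_weight_Ioc]
      ring
    · have h := h₂₃ a₁ a₂ Y α B η K₁ i j hY hα hi hj hB hη hY₁
      have h' := le_trans h (add_le_add (hfirst e₂₃) (hsecond hC₂₃ e₂₃))
      have h'' := weaken_second_term8 hSj hη0 hLY hC₀0 hx (by norm_num : 2 + 3 + 1 ≤ 7) h'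
      refine le_trans (le_of_eq ?_) h''
      congr 1
      refine Finset.sum_congr rfl fun k₁ _ ↦ Finset.sum_congr rfl fun k₂ _ ↦ ?_
      simp only [Finset.sum_range_succ, Finset.sum_range_zero, zero_add, add_zero, Nat.choose_self,
        Nat.choose_zero_right, Nat.choose_one_right, hc32, Nat.cast_one, Nat.cast_ofNat, Nat.sub_self, Nat.sub_zero,
        Nat.reduceSub, Nat.reduceAdd, Nat.cast_zero, Nat.cast_add, pow_zero, pow_one, one_mul, mul_one,
        integral_model_weight_Ioc]
      ring
    · have h := h₃₀ a₁ a₂ Y α B η K₁ i j hY hα hi hj hB hη hY₁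
      have h' := le_trans h (add_le_add (hfirst e₃₀) (hsecond hC₃₀ e₃₀))
      have h'' := weaken_second_term8 hSj hη0 hLY hC₀0 hx (by norm_num : 3 + 0 + 1 ≤ 7) h'
      refine le_trans (le_of_eq ?_) h''
      congr 1
      refine Finset.sum_congr rfl fun k₁ _ ↦ Finset.sum_congr rfl fun k₂ _ ↦ ?_
      simp only [Finset.sum_range_succ, Finset.sum_range_zero, zero_add, add_zero, Nat.choose_self,
        Nat.choose_zero_right, Nat.choose_one_right, hc32, Nat.cast_one, Nat.cast_ofNat, Nat.sub_self, Nat.sub_zero,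
        Nat.reduceSub, Nat.reduceAdd, Nat.cast_zero, Nat.cast_add, pow_zero, pow_one, one_mul, mul_one,
        integral_model_weight_Ioc]
      ring
    · have h := h₃₁ a₁ a₂ Y α B η K₁ i j hY hα hi hj hB hη hY₁
      have h' := le_trans h (add_le_add (hfirst e₃₁) (hsecond hC₃₁ e₃₁))
      have h'' := weaken_second_term8 hSj hη0 hLY hC₀0 hx (by norm_num : 3 + 1 + 1 ≤ 7) h'
      refine le_trans (le_of_eq ?_) h''
      congr 1
      refine Finset.sum_congr rfl fun k₁ _ ↦ Finset.sum_congr rfl fun k₂ _ ↦ ?_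
      simp only [Finset.sum_range_succ, Finset.sum_range_zero, zero_add, add_zero, Nat.choose_self,
        Nat.choose_zero_right, Nat.choose_one_right, hc32, Nat.cast_one, Nat.cast_ofNat, Nat.sub_self, Nat.sub_zero,
        Nat.reduceSub, Nat.reduceAdd, Nat.cast_zero, Nat.cast_add, pow_zero, pow_one, one_mul, mul_one,
        integral_model_weight_Ioc]
      ring
    · have h := h₃₂ a₁ a₂ Y α B η K₁ i j hY hα hi hj hB hη hY₁
      have h' := le_trans h (add_le_add (hfirst e₃₂) (hsecond hC₃₂ e₃₂))
      have h'' := weaken_second_term8 hSj hη0 hLY hC₀0 hx (by norm_num : 3 + 2 + 1 ≤ 7) h'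
      refine le_trans (le_of_eq ?_) h''
      congr 1
      refine Finset.sum_congr rfl fun k₁ _ ↦ Finset.sum_congr rfl fun k₂ _ ↦ ?_
      simp only [Finset.sum_range_succ, Finset.sum_range_zero, zero_add, add_zero, Nat.choose_self,
        Nat.choose_zero_right, Nat.choose_one_right, hc32, Nat.cast_one, Nat.cast_ofNat, Nat.sub_self, Nat.sub_zero,
        Nat.reduceSub, Nat.reduceAdd, Nat.cast_zero, Nat.cast_add, pow_zero, pow_one, one_mul, mul_one,
        integral_model_weight_Ioc]
      ring
    · have h := h₃₃ a₁ a₂ Y α B η K₁ i j hY hα hi hj hB hη hY₁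
      have h' := le_trans h (add_le_add (hfirst e₃₃) (hsecond hC₃₃ e₃₃))
      have h'' := weaken_second_term8 hSj hη0 hLY hC₀0 hx (by norm_num : 3 + 3 + 1 ≤ 7) h'
      refine le_trans (le_of_eq ?_) h''
      congr 1
      refine Finset.sum_congr rfl fun k₁ _ ↦ Finset.sum_congr rfl fun k₂ _ ↦ ?_
      simp only [Finset.sum_range_succ, Finset.sum_range_zero, zero_add, add_zero, Nat.choose_self,
        Nat.choose_zero_right, Nat.choose_one_right, hc32, Nat.cast_one, Nat.cast_ofNat, Nat.sub_self, Nat.sub_zero,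
        Nat.reduceSub, Nat.reduceAdd, Nat.cast_zero, Nat.cast_add, pow_zero, pow_one, one_mul, mul_one,
        integral_model_weight_Ioc]
      ring

end Summit.Parity.GeneralizedHardyLittlewood.Theorems.MomentsBeyondDiagonal.DiagCorner

end
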